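import Summits.BirchSwinnertonDyer.BirchSwinnertonDyer.Theorems.Rank2ObservatoryRank3CondCerts1
import Summits.BirchSwinnertonDyer.BirchSwinnertonDyer.Theorems.Rank2ObservatoryRank3CondCerts2
import Summits.BirchSwinnertonDyer.BirchSwinnertonDyer.Theorems.Rank2ObservatoryRank3CondCerts3
import Summits.BirchSwinnertonDyer.BirchSwinnertonDyer.Theorems.Rank2ObservatoryRank3CondCerts4
import Summits.BirchSwinnertonDyer.BirchSwinnertonDyer.Theorems.Rank2ObservatoryRank3CondCerts5
import Summits.BirchSwinnertonDyer.BirchSwinnertonDyer.Theorems.Rank2ObservatoryRank3CondCerts6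
import Summits.BirchSwinnertonDyer.BirchSwinnertonDyer.Theorems.Rank2ObservatoryRank3CondCerts7
import Summits.BirchSwinnertonDyer.BirchSwinnertonDyer.Theorems.Rank2ObservatoryRank3CondCerts8
import Summits.BirchSwinnertonDyer.BirchSwinnertonDyer.Theorems.Rank2ObservatoryRank3CondCerts9
import Summits.BirchSwinnertonDyer.BirchSwinnertonDyer.Theorems.Rank2ObservatoryRank3CondCerts10
import Summits.BirchSwinnertonDyer.BirchSwinnertonDyer.Theorems.Rank2ObservatoryRank3Step2Census
import Summits.BirchSwinnertonDyer.BirchSwinnertonDyer.Theorems.Rank2ObservatoryRank3ConductorFinal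
import HarnessLib

/-!
# BirchSwinnertonDyer — rank ≥ 2 observatory: `N_E = N` FOR EVERY ROW OF THE RANK-3 CENSUS,
# NO named fact, NO hypothesis beyond membership

HONEST FRAMING: per-curve certified theorems and census instruments; no claim on BSD in rank ≥ 2.

The closing file of the conductor programme of unit `b2b-bsdr2-cert-2` (gens 5–7).  The `9487` rows of
the rank-3 census `rank3Table` are covered by three kernel-certified instruments:

* `5347` rows tame at `2` and at `3` — `Rank3Row.conductorNorm_eq_of_mem_of_tame23` (gen 6);
* `749` rows of Kodaira type `II/III/IV` at `2` with a gen-5 certificate — the Step-2 Tate certificates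
  `rank3Step2Certs` (gen 6, `Rank3Row.conductorNorm_eq_of_mem_step2Certs`);
* the remaining `3391` rows (`1841` of deep type `I₀*/Iₙ*/IV*/III*` at `2`, `1550` additive at `3`) —
  the local Tate certificates `rank3CondCerts` of this generation (chunks `Rank3CondCerts1–10`,
  `Rank3Row.conductorNorm_eq_of_mem_condCerts` below).

`condCoverWalk` checks IN THE KERNEL, in one pass over `rank3Table`, that every row is tame at `2` and `3`
or indexed by one of the two certificate lists; hence the headline

**`Rank3Row.conductorNorm_eq_of_mem : r ∈ rank3Table → conductorNorm ℤ E_r = r.N`** for ALL `9487`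
rows — the hypothesis `hN` of every census headline of gens 2–6 is DISCHARGED, and the named Table-II
fact `h3` (`conductorExponent_eq_tableConductorExponentThree`) is no longer used anywhere on the census
(Tate's algorithm at `3` now runs in the kernel, per curve) — and the census headline
`Rank3Row.rank3_lderiv_eq_zero_of_mem` (`L'(E,1) = 0` over `K = ℚ(√D)`, `hN`/`hmin`/`hlow` gone; the
remaining hypotheses are the analytic inputs `hE`, `hGZKK`, `hLD` and the root-number dictionary
`hKD`/`hR`, exactly as in gen 6).

References: J. H. Silverman, *Advanced Topics in the Arithmetic of Elliptic Curves*, GTM 151 (1994),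
IV.9.4, IV.10.2, IV.11.1 [Silverman1994]; J. E. Cremona, *Algorithms for Modular Elliptic Curves*,
2nd ed. (1997), Tables [CremonaAlgorithms1997]; B. H. Gross, in *L-functions and Arithmetic*, LMS LN 153
(1991) [GrossLMS1991].
-/

open WeierstrassCurve IsDedekindDomain Literature Literature.NumberTheory.EllipticCurves

namespace Summit.BirchSwinnertonDyer.BirchSwinnertonDyer.Rank2Observatory

open RootNumber Tate

/-- All local Tate certificates at `2` and `3` of the rank-3 census (chunks 1–10). [folklore] -/
def rank3CondCerts : List (ℕ × CondCert) :=
  rank3CondCerts1 ++ rank3CondCerts2 ++ rank3CondCerts3 ++ rank3CondCerts4 ++ rank3CondCerts5 ++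
    rank3CondCerts6 ++ rank3CondCerts7 ++ rank3CondCerts8 ++ rank3CondCerts9 ++ rank3CondCerts10

/-- `3391` certificate pairs. [cite: CremonaAlgorithms1997, Tables] -/
theorem rank3CondCerts_length : rank3CondCerts.length = 3391 := by
  decide +kernel

/-- Census of the local certificates at `2` by kind (good, multiplicative, Step-2, deep):
`(612, 504, 123, 2152)`. [cite: Silverman1994, IV.9.4] -/
theorem rank3CondCerts_kinds_two :
    ((rank3CondCerts.countP fun e => e.2.l₂.kind == 0), (rank3CondCerts.countP fun e => e.2.l₂.kind == 1),
      (rank3CondCerts.countP fun e => e.2.l₂.kind == 2), (rank3CondCerts.countP fun e => e.2.l₂.kind == 3)) =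
      (612, 504, 123, 2152) := by
  decide +kernel

/-- **`N_E = N` for every row listed in `rank3CondCerts`** (the ten kernel walks). [cite: Silverman1994,
IV.10.2 and IV.11.1] [cite: CremonaAlgorithms1997, Tables] -/
theorem Rank3Row.conductorNorm_eq_of_mem_condCerts {i : ℕ} {cc : CondCert} (hm : (i, cc) ∈ rank3CondCerts) :
    ∃ hi : i < rank3Table.length, (rank3Table[i]'hi).curve.conductorNorm ℤ = (rank3Table[i]'hi).N := by
  simp only [rank3CondCerts, List.mem_append] at hm
  rcases hm with ((((((((h | h) | h) | h) | h) | h) | h) | h) | h) | h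
  · exact Rank3Row.conductorNorm_eq_of_condWalk rank3Table_condWalk1 h
  · exact Rank3Row.conductorNorm_eq_of_condWalk rank3Table_condWalk2 h
  · exact Rank3Row.conductorNorm_eq_of_condWalk rank3Table_condWalk3 h
  · exact Rank3Row.conductorNorm_eq_of_condWalk rank3Table_condWalk4 h
  · exact Rank3Row.conductorNorm_eq_of_condWalk rank3Table_condWalk5 h
  · exact Rank3Row.conductorNorm_eq_of_condWalk rank3Table_condWalk6 h
  · exact Rank3Row.conductorNorm_eq_of_condWalk rank3Table_condWalk7 h
  · exact Rank3Row.conductorNorm_eq_of_condWalk rank3Table_condWalk8 h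
  · exact Rank3Row.conductorNorm_eq_of_condWalk rank3Table_condWalk9 h
  · exact Rank3Row.conductorNorm_eq_of_condWalk rank3Table_condWalk10 h

/-! ### Coverage: every census row is tame at `2` and `3` or carries a certificate -/

/-- One-pass coverage walk: row `n` is tame at `2` and at `3`, or `n` heads the (sorted) remaining
Step-2 index list, or `n` heads the remaining local-certificate index list. [folklore] -/
def condCoverWalk : List Rank3Row → ℕ → List ℕ → List ℕ → Bool
  | [], _, _, _ => true
  | r :: rs, n, s, c =>
      ((r.tameAtTwo && r.tameAtThree) || s.head? == some n || c.head? == some n) &&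
        condCoverWalk rs (n + 1) (if s.head? == some n then s.tail else s)
          (if c.head? == some n then c.tail else c)

/-- `l.head? = some n → n ∈ l`. [folklore] -/
private theorem mem_of_head?_eq {l : List ℕ} {n : ℕ} (h : l.head? = some n) : n ∈ l := by
  cases l with
  | nil => simp at h
  | cons a tl =>
    simp only [List.head?_cons, Option.some.injEq] at h
    subst h; simp

/-- What a passing coverage walk says about each row. [folklore] -/
theorem of_condCoverWalk :
    ∀ (rows : List Rank3Row) (n : ℕ) (s c : List ℕ), condCoverWalk rows n s c = true →
      ∀ (k : ℕ) (hk : k < rows.length),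
        ((rows[k]'hk).tameAtTwo = true ∧ (rows[k]'hk).tameAtThree = true) ∨ n + k ∈ s ∨ n + k ∈ c
  | [], _, _, _, _, k, hk => absurd hk (Nat.not_lt_zero k)
  | r :: rs, n, s, c, h, k, hk => by
    simp only [condCoverWalk, Bool.and_eq_true, Bool.or_eq_true, beq_iff_eq] at h
    obtain ⟨hhead, htail⟩ := h
    cases k with
    | zero =>
      rw [Nat.add_zero]
      rcases hhead with (ht | hs) | hc
      · exact Or.inl ht
      · exact Or.inr (Or.inl (mem_of_head?_eq hs))
      · exact Or.inr (Or.inr (mem_of_head?_eq hc))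
    | succ k =>
      have hk' : k < rs.length := by simpa using hk
      have ih := of_condCoverWalk rs (n + 1) _ _ htail k hk'
      rw [show n + (k + 1) = n + 1 + k by omega]
      rcases ih with ht | hs | hc
      · exact Or.inl ht
      · refine Or.inr (Or.inl ?_)
        split at hs
        · exact List.mem_of_mem_tail hs
        · exact hs
      · refine Or.inr (Or.inr ?_)
        split at hc
        · exact List.mem_of_mem_tail hc
        · exact hc

/-- KERNEL COVERAGE CHECK: every one of the `9487` census rows is tame at `2` and `3`, or indexed by
`rank3Step2Certs`, or indexed by `rank3CondCerts`. [cite: CremonaAlgorithms1997, Tables] -/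
theorem rank3_condCoverWalk :
    condCoverWalk rank3Table 0 (rank3Step2Certs.map Prod.fst) (rank3CondCerts.map Prod.fst) = true := by
  decide +kernel

/-- **THE CONDUCTOR OF EVERY RANK-3 CENSUS CURVE — `conductorNorm ℤ E_r = r.N` for all `9487` rows of
`rank3Table`, NO named fact, NO hypothesis beyond membership.**  (Tame rows: gen 6; type `II/III/IV`
at `2`: the gen-6 Step-2 Tate certificates; all other rows: the gen-7 local Tate certificates at `2`
and `3`, with global minimality from the gen-5 Kraus–Laska census.) [cite: Silverman1994, IV.10.2 and
IV.11.1] [cite: CremonaAlgorithms1997, Tables] -/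
theorem Rank3Row.conductorNorm_eq_of_mem {r : Rank3Row} (hr : r ∈ rank3Table) :
    r.curve.conductorNorm ℤ = r.N := by
  obtain ⟨i, hi, rfl⟩ := List.getElem_of_mem hr
  rcases of_condCoverWalk _ 0 _ _ rank3_condCoverWalk i hi with ⟨h2, h3⟩ | h | h
  · exact Rank3Row.conductorNorm_eq_of_mem_of_tame23 hr h2 h3
  · rw [Nat.zero_add] at h
    obtain ⟨⟨j, tc⟩, hm, hj⟩ := List.mem_map.mp h
    dsimp only at hj
    subst hj
    obtain ⟨hi', hN⟩ := Rank3Row.conductorNorm_eq_of_mem_step2Certs hm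
    exact hN
  · rw [Nat.zero_add] at h
    obtain ⟨⟨j, cc⟩, hm, hj⟩ := List.mem_map.mp h
    dsimp only at hj
    subst hj
    obtain ⟨hi', hN⟩ := Rank3Row.conductorNorm_eq_of_mem_condCerts hm
    exact hN

/-- Index form. [cite: CremonaAlgorithms1997, Tables] -/
theorem Rank3Row.conductorNorm_eq_getElem (i : ℕ) (hi : i < rank3Table.length) :
    (rank3Table[i]'hi).curve.conductorNorm ℤ = (rank3Table[i]'hi).N :=
  Rank3Row.conductorNorm_eq_of_mem (List.getElem_mem hi)

/-! ### The census headline with `hN` discharged -/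

/-- **`L′(E,1) = 0` over `K = ℚ(√D)` for EVERY rank-3 census row** — the gen-6 kernel headline
`Rank3Row.rank3_lderiv_eq_zero_kernel_wm` with its conductor hypothesis `hN` DISCHARGED by
`Rank3Row.conductorNorm_eq_of_mem`; what remains are the analytic inputs (`hE` entire continuation,
`hGZKK` Gross–Zagier–Kolyvagin over `K`, `hLD` non-vanishing of the twist) and the root-number
dictionary (`hKD`, `hR`). [cite: GrossLMS1991, (1.1) and Thm. 1.3] -/
theorem Rank3Row.rank3_lderiv_eq_zero_of_mem {r : Rank3Row} (hr : r ∈ rank3Table) (K : Type)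
    [Field K] [NumberField K] (hE : WeierstrassCurve.hasEntireLFunction_rat)
    (hGZKK : mordellWeilRank_eq_one_of_LDerivEK_ne_zero r.curve K)
    (hK : IsImaginaryQuadratic K) (hdK : NumberField.discr K = r.D)
    (hKD : r.curve.rootNumber_eq_neg_finprod_tableLocalRootNumberAt')
    (hR : r.curve.rootNumber_eq_neg_finprod_fullTableLocalRootNumberAt)
    (hLD : (r.curve.quadraticTwist (r.D : ℚ)).entireLFunction 1 ≠ 0) :
    deriv r.curve.entireLFunction 1 = 0 :=
  Rank3Row.rank3_lderiv_eq_zero_kernel_wm hr K hE hGZKK (Rank3Row.conductorNorm_eq_of_mem hr) hK hdK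
    hKD hR hLD

/-! ### Self-tests -/

/-- `N(20888a1) = 20888` (row `9`, type `I₁*` at `2`: the first deep row) with NO hypothesis.
[cite: CremonaAlgorithms1997, Tables] -/
theorem conductorNorm_row9 :
    (rank3Table[9]'(by rw [rank3Table_length]; omega)).curve.conductorNorm ℤ = 20888 := by
  rw [Rank3Row.conductorNorm_eq_getElem]; decide +kernel

/-- `N(499878d1) = 499878` (row `9483`, the last certified row, additive at `3`) with NO hypothesis.
[cite: CremonaAlgorithms1997, Tables] -/
theorem conductorNorm_row9483 :
    (rank3Table[9483]'(by rw [rank3Table_length]; omega)).curve.conductorNorm ℤ = 499878 := by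
  rw [Rank3Row.conductorNorm_eq_getElem]; decide +kernel

end Summit.BirchSwinnertonDyer.BirchSwinnertonDyer.Rank2Observatory
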